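import Literature.NumberTheory.Transcendental.BoxIntegralHurwitzWeightTwo
import Literature.Analysis.SpecialFunctions.TanhPartialFractions
import HarnessLib

/-!
# The weight-`2`, level-`4` box sector: `H₀,…,H₃ ∈ ℚ·G + ℚ·π²` (`G` = Catalan's constant),
`∫_{(0,1)²} dx/(1 + (x₀x₁)²) = G`, and the normal form `a + bπ²/6 + cG`

Sequel of `BoxIntegralHurwitzWeightTwo.lean` (the Hurwitz box integrals
`H_r = ∫_{(0,1)²}(x₀x₁)ʳ/(1 − (x₀x₁)ᵐ) = Σ_k (mk+r+1)⁻²` and the level-`6` sector), at level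
`m = 4`, where the values live in `ℚ·G + ℚ·π²` with `G = Σ_k (−1)ᵏ/(2k+1)²` Catalan's constant
(the tree's `catalanConstant` of `PeriodsWave0.lean`): with `V_r := Σ_k 1/(4k+r)²`,
`V₁ + V₃ = Σ_{odd} n⁻² = π²/8` (Euler) and `V₁ − V₃ = G`, `V₂ = π²/32`, `V₄ = π²/96`. This is the
"next rung" of route HurwitzMicroSectors of summit KontsevichZagierPeriods (item
CatalanSectorTwoFour: "values in `ℚ + ℚπ² + ℚG` (`G = ∫∫dxdy/(1+x²y²) = h₀ − h₂`), normal forms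
`a + b/(1−xy) + c/(1+x²y²)`, reduction by ONE dilation `m = 2` (`H₁ ∼ 3H₃`, `H₀ + H₂ ∼ 12H₃`) …
on this rung Conjecture 1 costs exactly `Indep(1, π², G)`", an OPEN hypothesis).

This file PROVES:

* the four series `tsum_one_div_four_mul_add_one_sq` (`π²/16 + G/2`), `…_two_sq` (`π²/32`),
  `…_three_sq` (`π²/16 − G/2`), `…_four_sq` (`π²/96`) (even/odd splits of
  `Literature.Analysis.SpecialFunctions.hasSum_one_div_odd_sq` and `hasSum_catalanConstant`);
* the level-`4` box values `setIntegral_box_level_four_zero … _three` (`H₀ = π²/16 + G/2`,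
  `H₁ = π²/32`, `H₂ = π²/16 − G/2`, `H₃ = π²/96`) and `level_four_relations` (`H₁ = 3H₃`,
  `H₀ + H₂ = 12H₃`) as exact identities;
* **`box_integral_catalan`** — `1/(1 + (x₀x₁)²)` is integrable on the open unit box and
  `∫_{(0,1)²} dx/(1 + (x₀x₁)²) = Σ_k (−1)ᵏ/(2k+1)² = G` (`1/(1+t²) = (1−t²)/(1−t⁴)`: `G = H₀ − H₂`);
* `box_integral_normalForm_level_four` — `∫_{(0,1)²}(a + b/(1−x₀x₁) + c/(1+(x₀x₁)²)) = a + bπ²/6 + cG`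
  with integrability, and `normalForm_level_four_coeff_eq` — coefficient rigidity under the item's
  literal (open) hypothesis `LinearIndependent ℚ ![1, π², Σ(−1)ⁿ/(2n+1)²]`.

No named facts (D-0026); only `normalForm_level_four_coeff_eq` carries a hypothesis (explicitly).

## References

* [KontsevichZagier2001] M. Kontsevich, D. Zagier, *Periods* (2001), §1.1.
* [Finch2003] S. R. Finch, *Mathematical Constants* (2003), §1.7 (Catalan's constant `G = β(2)`),
  through `PeriodsWave0.lean` / `CatalanConstantBeta.lean`.
-/

noncomputable section

open MeasureTheory Set Filter Real Finset

namespace Literature.NumberTheory.Transcendental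

namespace BoxIntegral

/-! ### The four series `Σ_k 1/(4k+r)²`, `r = 1, 2, 3, 4` -/

/-- `Σ_k 1/(4k+r)²` converges (`r ≥ 1`; a sub-case of `summable_one_div_mul_add_sq`). [folklore] -/
theorem summable_one_div_four_mul_add_sq (r : ℕ) :
    Summable fun k : ℕ => 1 / ((4 : ℝ) * k + r + 1) ^ 2 := by
  simpa using summable_one_div_mul_add_sq (m := 4) (by norm_num) r

/-- **`Σ_k 1/(4k+1)² + Σ_k 1/(4k+3)² = π²/8`** (even/odd split of Euler's odd-square sum
`Σ_k 1/(2k+1)² = π²/8`). [folklore] -/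
theorem tsum_one_div_four_mul_add_one_sq_add :
    (∑' k : ℕ, 1 / ((4 : ℝ) * k + 1) ^ 2) + ∑' k : ℕ, 1 / ((4 : ℝ) * k + 3) ^ 2 = Real.pi ^ 2 / 8 := by
  have h1 : HasSum (fun k : ℕ => 1 / (2 * ((2 * k : ℕ) : ℝ) + 1) ^ 2)
      (∑' k : ℕ, 1 / ((4 : ℝ) * k + 1) ^ 2) := by
    have hs := summable_one_div_four_mul_add_sq 0
    simp only [Nat.cast_zero, add_zero] at hs
    refine hs.hasSum.congr_fun fun k => ?_
    push_cast
    ring_nf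
  have h3 : HasSum (fun k : ℕ => 1 / (2 * ((2 * k + 1 : ℕ) : ℝ) + 1) ^ 2)
      (∑' k : ℕ, 1 / ((4 : ℝ) * k + 3) ^ 2) := by
    have hs := summable_one_div_four_mul_add_sq 2
    have hs' : Summable (fun k : ℕ => 1 / ((4 : ℝ) * k + 3) ^ 2) := by
      refine hs.congr fun k => ?_
      push_cast
      ring_nf
    refine hs'.hasSum.congr_fun fun k => ?_
    push_cast
    ring_nf
  exact (HasSum.even_add_odd (f := fun k : ℕ => 1 / (2 * (k : ℝ) + 1) ^ 2) h1 h3).unique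
    Literature.Analysis.SpecialFunctions.hasSum_one_div_odd_sq

/-- **`Σ_k 1/(4k+1)² − Σ_k 1/(4k+3)² = G`** (even/odd split of Catalan's series
`G = Σ_k (−1)ᵏ/(2k+1)²`, the tree's `catalanConstant`). [folklore] -/
theorem tsum_one_div_four_mul_add_one_sq_sub :
    (∑' k : ℕ, 1 / ((4 : ℝ) * k + 1) ^ 2) - ∑' k : ℕ, 1 / ((4 : ℝ) * k + 3) ^ 2 = catalanConstant := by
  have h1 : HasSum (fun k : ℕ => (-1 : ℝ) ^ (2 * k : ℕ) / ((2 * ((2 * k : ℕ) : ℝ) + 1)) ^ 2)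
      (∑' k : ℕ, 1 / ((4 : ℝ) * k + 1) ^ 2) := by
    have hs := summable_one_div_four_mul_add_sq 0
    simp only [Nat.cast_zero, add_zero] at hs
    refine hs.hasSum.congr_fun fun k => ?_
    rw [pow_mul, neg_one_sq, one_pow]
    push_cast
    ring_nf
  have h3 : HasSum (fun k : ℕ => (-1 : ℝ) ^ (2 * k + 1 : ℕ) / ((2 * ((2 * k + 1 : ℕ) : ℝ) + 1)) ^ 2)
      (-(∑' k : ℕ, 1 / ((4 : ℝ) * k + 3) ^ 2)) := by
    have hs := summable_one_div_four_mul_add_sq 2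
    have hs' : Summable (fun k : ℕ => 1 / ((4 : ℝ) * k + 3) ^ 2) := by
      refine hs.congr fun k => ?_
      push_cast
      ring_nf
    refine hs'.hasSum.neg.congr_fun fun k => ?_
    rw [pow_succ, pow_mul, neg_one_sq, one_pow, one_mul]
    push_cast
    ring_nf
  have h := (HasSum.even_add_odd (f := fun k : ℕ => (-1 : ℝ) ^ k / ((2 * (k : ℝ) + 1)) ^ 2) h1 h3).unique
    hasSum_catalanConstant
  linarith

/-- `Σ_k 1/(4k+1)² = π²/16 + G/2`. [folklore] -/
theorem tsum_one_div_four_mul_add_one_sq :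
    ∑' k : ℕ, 1 / ((4 : ℝ) * k + 1) ^ 2 = Real.pi ^ 2 / 16 + catalanConstant / 2 := by
  have ha := tsum_one_div_four_mul_add_one_sq_add
  have hb := tsum_one_div_four_mul_add_one_sq_sub
  linarith

/-- `Σ_k 1/(4k+3)² = π²/16 − G/2`. [folklore] -/
theorem tsum_one_div_four_mul_add_three_sq :
    ∑' k : ℕ, 1 / ((4 : ℝ) * k + 3) ^ 2 = Real.pi ^ 2 / 16 - catalanConstant / 2 := by
  have ha := tsum_one_div_four_mul_add_one_sq_add
  have hb := tsum_one_div_four_mul_add_one_sq_sub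
  linarith

/-- `Σ_k 1/(4k+2)² = ¼ Σ_k 1/(2k+1)² = π²/32`. [folklore] -/
theorem tsum_one_div_four_mul_add_two_sq :
    ∑' k : ℕ, 1 / ((4 : ℝ) * k + 2) ^ 2 = Real.pi ^ 2 / 32 := by
  have h := Literature.Analysis.SpecialFunctions.hasSum_one_div_odd_sq.mul_left (1 / 4)
  have h' : HasSum (fun k : ℕ => 1 / ((4 : ℝ) * k + 2) ^ 2) (1 / 4 * (Real.pi ^ 2 / 8)) := by
    refine h.congr_fun fun k => ?_
    have : ((4 : ℝ) * k + 2) ^ 2 = 4 * (2 * (k : ℝ) + 1) ^ 2 := by ring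
    rw [this, ← one_div_mul_one_div]
  rw [h'.tsum_eq]
  ring

/-- `Σ_k 1/(4k+4)² = (1/16) Σ_k 1/(k+1)² = π²/96`. [folklore] -/
theorem tsum_one_div_four_mul_add_four_sq :
    ∑' k : ℕ, 1 / ((4 : ℝ) * k + 4) ^ 2 = Real.pi ^ 2 / 96 := by
  have hz : HasSum (fun k : ℕ => 1 / ((k : ℝ) + 1) ^ 2) (Real.pi ^ 2 / 6) := by
    have h := (hasSum_nat_add_iff' 1).mpr hasSum_zeta_two
    simp only [Finset.sum_range_one, Nat.cast_zero, ne_eq, OfNat.ofNat_ne_zero, not_false_eq_true,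
      zero_pow, div_zero, sub_zero] at h
    refine h.congr_fun fun k => ?_
    push_cast
    ring_nf
  have h' : HasSum (fun k : ℕ => 1 / ((4 : ℝ) * k + 4) ^ 2) (1 / 16 * (Real.pi ^ 2 / 6)) := by
    refine (hz.mul_left (1 / 16)).congr_fun fun k => ?_
    have : ((4 : ℝ) * k + 4) ^ 2 = 16 * ((k : ℝ) + 1) ^ 2 := by ring
    rw [this, ← one_div_mul_one_div]
  rw [h'.tsum_eq]
  ring

/-! ### Level `4`: `H_r = ∫_{(0,1)²} (x₀x₁)ʳ dx/(1 − (x₀x₁)⁴)`, `r = 0,…,3` -/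

/-- `H₀ = Σ 1/(4k+1)² = π²/16 + G/2`. [folklore] -/
theorem setIntegral_box_level_four_zero :
    ∫ x in {x : Fin 2 → ℝ | ∀ i, x i ∈ Ioo (0 : ℝ) 1}, (x 0 * x 1) ^ 0 / (1 - (x 0 * x 1) ^ 4)
      = Real.pi ^ 2 / 16 + catalanConstant / 2 := by
  rw [setIntegral_box_pow_div_one_sub_pow (by norm_num) 0, ← tsum_one_div_four_mul_add_one_sq]
  refine tsum_congr fun k => ?_
  push_cast
  ring_nf

/-- `H₁ = Σ 1/(4k+2)² = π²/32`. [folklore] -/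
theorem setIntegral_box_level_four_one :
    ∫ x in {x : Fin 2 → ℝ | ∀ i, x i ∈ Ioo (0 : ℝ) 1}, (x 0 * x 1) ^ 1 / (1 - (x 0 * x 1) ^ 4)
      = Real.pi ^ 2 / 32 := by
  rw [setIntegral_box_pow_div_one_sub_pow (by norm_num) 1, ← tsum_one_div_four_mul_add_two_sq]
  refine tsum_congr fun k => ?_
  push_cast
  ring_nf

/-- `H₂ = Σ 1/(4k+3)² = π²/16 − G/2`. [folklore] -/
theorem setIntegral_box_level_four_two :
    ∫ x in {x : Fin 2 → ℝ | ∀ i, x i ∈ Ioo (0 : ℝ) 1}, (x 0 * x 1) ^ 2 / (1 - (x 0 * x 1) ^ 4)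
      = Real.pi ^ 2 / 16 - catalanConstant / 2 := by
  rw [setIntegral_box_pow_div_one_sub_pow (by norm_num) 2, ← tsum_one_div_four_mul_add_three_sq]
  refine tsum_congr fun k => ?_
  push_cast
  ring_nf

/-- `H₃ = Σ 1/(4k+4)² = π²/96`. [folklore] -/
theorem setIntegral_box_level_four_three :
    ∫ x in {x : Fin 2 → ℝ | ∀ i, x i ∈ Ioo (0 : ℝ) 1}, (x 0 * x 1) ^ 3 / (1 - (x 0 * x 1) ^ 4)
      = Real.pi ^ 2 / 96 := by
  rw [setIntegral_box_pow_div_one_sub_pow (by norm_num) 3, ← tsum_one_div_four_mul_add_four_sq]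
  refine tsum_congr fun k => ?_
  push_cast
  ring_nf

/-- **The two level-`4` distribution relations**: `H₁ = 3H₃` and `H₀ + H₂ = 12H₃` (the `m = 2`
dilation of route HurwitzMicroSectors, item CatalanSectorTwoFour: "reduction by ONE dilation `m = 2`
(`H₁ ∼ 3H₃`, `H₀ + H₂ ∼ 12H₃`)"), as exact identities of the box integrals. [folklore] -/
theorem level_four_relations :
    (∫ x in {x : Fin 2 → ℝ | ∀ i, x i ∈ Ioo (0 : ℝ) 1}, (x 0 * x 1) ^ 1 / (1 - (x 0 * x 1) ^ 4))
        = 3 * ∫ x in {x : Fin 2 → ℝ | ∀ i, x i ∈ Ioo (0 : ℝ) 1}, (x 0 * x 1) ^ 3 / (1 - (x 0 * x 1) ^ 4) ∧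
    (∫ x in {x : Fin 2 → ℝ | ∀ i, x i ∈ Ioo (0 : ℝ) 1}, (x 0 * x 1) ^ 0 / (1 - (x 0 * x 1) ^ 4))
        + (∫ x in {x : Fin 2 → ℝ | ∀ i, x i ∈ Ioo (0 : ℝ) 1}, (x 0 * x 1) ^ 2 / (1 - (x 0 * x 1) ^ 4))
        = 12 * ∫ x in {x : Fin 2 → ℝ | ∀ i, x i ∈ Ioo (0 : ℝ) 1}, (x 0 * x 1) ^ 3 / (1 - (x 0 * x 1) ^ 4) := by
  rw [setIntegral_box_level_four_zero, setIntegral_box_level_four_one, setIntegral_box_level_four_two,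
    setIntegral_box_level_four_three]
  refine ⟨by ring, by ring⟩

/-! ### Catalan's constant as a box integral: `∫_{(0,1)²} dx/(1 + (x₀x₁)²) = G` -/

/-- **`1/(1 + (x₀x₁)²)` is integrable on the open unit box** (bounded by `1`). [folklore] -/
theorem integrableOn_box_one_div_one_add_sq :
    IntegrableOn (fun x : Fin 2 → ℝ => 1 / (1 + (x 0 * x 1) ^ 2)) {x | ∀ i, x i ∈ Ioo (0 : ℝ) 1} volume := by
  refine Integrable.mono' (integrableOn_box_const 2 1)
    ((by fun_prop : Measurable fun x : Fin 2 → ℝ => 1 / (1 + (x 0 * x 1) ^ 2)).aestronglyMeasurable)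
    (ae_of_all _ fun x => ?_)
  have hpos : 0 < 1 + (x 0 * x 1) ^ 2 := by positivity
  rw [Real.norm_eq_abs, abs_of_pos (one_div_pos.mpr hpos), div_le_one hpos]
  nlinarith [sq_nonneg (x 0 * x 1)]

/-- **Catalan's constant as a period over the open unit box**:
`∫_{(0,1)²} dx₀dx₁/(1 + (x₀x₁)²) = G = Σ_k (−1)ᵏ/(2k+1)²` — via
`1/(1+t²) = 1/(1−t⁴) − t²/(1−t⁴)`, i.e. `G = H₀ − H₂` at level `4`. [folklore] -/
theorem setIntegral_box_one_div_one_add_sq :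
    ∫ x in {x : Fin 2 → ℝ | ∀ i, x i ∈ Ioo (0 : ℝ) 1}, 1 / (1 + (x 0 * x 1) ^ 2) = catalanConstant := by
  have h0 := box_integral_pow_div_one_sub_pow (m := 4) (by norm_num) 0
  have h2 := box_integral_pow_div_one_sub_pow (m := 4) (by norm_num) 2
  have hsplit : ∀ x ∈ {x : Fin 2 → ℝ | ∀ i, x i ∈ Ioo (0 : ℝ) 1},
      1 / (1 + (x 0 * x 1) ^ 2)
        = (x 0 * x 1) ^ 0 / (1 - (x 0 * x 1) ^ 4) - (x 0 * x 1) ^ 2 / (1 - (x 0 * x 1) ^ 4) := by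
    intro x hx
    have ht := mul_mem_Ioo_of_mem_box hx
    have hne2 : 1 - (x 0 * x 1) ^ 2 ≠ 0 := by
      have : (x 0 * x 1) ^ 2 < 1 := pow_lt_one₀ ht.1.le ht.2 two_ne_zero
      linarith
    rw [pow_zero, div_sub_div_same,
      show (1 : ℝ) - (x 0 * x 1) ^ 4 = (1 - (x 0 * x 1) ^ 2) * (1 + (x 0 * x 1) ^ 2) by ring,
      div_mul_cancel_left₀ hne2, one_div]
  rw [setIntegral_congr_fun (Beukers.measurableSet_cube 2) hsplit, integral_sub h0.1 h2.1,
    setIntegral_box_level_four_zero, setIntegral_box_level_four_two]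
  ring

/-- **Catalan box integral, conjunction form** (integrability and value, with the printed series
`Σ_k (−1)ᵏ/(2k+1)²`, `= catalanConstant` by definition). [folklore] -/
theorem box_integral_catalan :
    IntegrableOn (fun x : Fin 2 → ℝ => 1 / (1 + (x 0 * x 1) ^ 2)) {x | ∀ i, x i ∈ Ioo (0 : ℝ) 1} volume ∧
      ∫ x in {x : Fin 2 → ℝ | ∀ i, x i ∈ Ioo (0 : ℝ) 1}, 1 / (1 + (x 0 * x 1) ^ 2)
        = ∑' n : ℕ, (-1 : ℝ) ^ n / (2 * (n : ℝ) + 1) ^ 2 :=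
  ⟨integrableOn_box_one_div_one_add_sq, setIntegral_box_one_div_one_add_sq⟩

/-! ### The level-`4` normal form `a + b/(1 − x₀x₁) + c/(1 + (x₀x₁)²)` -/

/-- **The level-`4` normal-form integral**:
`∫_{(0,1)²} (a + b/(1 − x₀x₁) + c/(1 + (x₀x₁)²)) dx = a + b·π²/6 + c·G`, with the integrability.
[folklore] -/
theorem box_integral_normalForm_level_four (a b c : ℝ) :
    IntegrableOn (fun x : Fin 2 → ℝ => a + b / (1 - x 0 * x 1) + c / (1 + (x 0 * x 1) ^ 2))
        {x | ∀ i, x i ∈ Ioo (0 : ℝ) 1} volume ∧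
      ∫ x in {x : Fin 2 → ℝ | ∀ i, x i ∈ Ioo (0 : ℝ) 1}, (a + b / (1 - x 0 * x 1) + c / (1 + (x 0 * x 1) ^ 2))
        = a + b * (Real.pi ^ 2 / 6) + c * catalanConstant := by
  have h1 := box_integral_one_div_one_sub_mul_two
  have h2 := box_integral_catalan
  have ha := integrableOn_box_const 2 a
  have hb : IntegrableOn (fun x : Fin 2 → ℝ => b / (1 - x 0 * x 1)) {x | ∀ i, x i ∈ Ioo (0 : ℝ) 1} volume := by
    have hb' : IntegrableOn (fun x : Fin 2 → ℝ => b * (1 / (1 - x 0 * x 1)))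
        {x | ∀ i, x i ∈ Ioo (0 : ℝ) 1} volume := h1.1.const_mul b
    refine IntegrableOn.congr_fun hb' (fun x _ => ?_) (Beukers.measurableSet_cube 2)
    simp only [mul_one_div]
  have hc : IntegrableOn (fun x : Fin 2 → ℝ => c / (1 + (x 0 * x 1) ^ 2)) {x | ∀ i, x i ∈ Ioo (0 : ℝ) 1} volume := by
    have hc' : IntegrableOn (fun x : Fin 2 → ℝ => c * (1 / (1 + (x 0 * x 1) ^ 2)))
        {x | ∀ i, x i ∈ Ioo (0 : ℝ) 1} volume := h2.1.const_mul c
    refine IntegrableOn.congr_fun hc' (fun x _ => ?_) (Beukers.measurableSet_cube 2)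
    simp only [mul_one_div]
  have hab : IntegrableOn (fun x : Fin 2 → ℝ => a + b / (1 - x 0 * x 1))
      {x | ∀ i, x i ∈ Ioo (0 : ℝ) 1} volume := ha.add hb
  refine ⟨hab.add hc, ?_⟩
  rw [integral_add hab hc, integral_add ha hb, setIntegral_box_const]
  have eb : ∫ x in {x : Fin 2 → ℝ | ∀ i, x i ∈ Ioo (0 : ℝ) 1}, b / (1 - x 0 * x 1)
      = b * (Real.pi ^ 2 / 6) := by
    rw [← h1.2, ← integral_const_mul]
    refine setIntegral_congr_fun (Beukers.measurableSet_cube 2) fun x _ => ?_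
    rw [mul_one_div]
  have ec : ∫ x in {x : Fin 2 → ℝ | ∀ i, x i ∈ Ioo (0 : ℝ) 1}, c / (1 + (x 0 * x 1) ^ 2)
      = c * catalanConstant := by
    rw [← setIntegral_box_one_div_one_add_sq, ← integral_const_mul]
    refine setIntegral_congr_fun (Beukers.measurableSet_cube 2) fun x _ => ?_
    rw [mul_one_div]
  rw [eb, ec]

/-- **Rigidity of the level-`4` normal form under `Indep(1, π², G)`** (the OPEN hypothesis of
route item CatalanSectorTwoFour, taken literally as `LinearIndependent ℚ ![1, π², Σ (−1)ⁿ/(2n+1)²]`):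
equal values of two rational normal forms force equal coefficients. [folklore] -/
theorem normalForm_level_four_coeff_eq
    (h : LinearIndependent ℚ ![(1 : ℝ), Real.pi ^ 2, (∑' n : ℕ, (-1 : ℝ) ^ n / (2 * (n : ℝ) + 1) ^ 2)])
    {a b c a' b' c' : ℚ}
    (heq : (a : ℝ) + b * (Real.pi ^ 2 / 6) + c * catalanConstant
      = a' + b' * (Real.pi ^ 2 / 6) + c' * catalanConstant) :
    a = a' ∧ b = b' ∧ c = c' := by
  have hrel : ((a - a' : ℚ) : ℝ) + ((b - b') / 6 : ℚ) * Real.pi ^ 2 + ((c - c' : ℚ)) * catalanConstant = 0 := by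
    push_cast
    linarith
  have h3 := Fintype.linearIndependent_iff.mp h ![a - a', (b - b') / 6, c - c'] (by
    rw [Fin.sum_univ_three]
    simp only [Matrix.cons_val_zero, Matrix.cons_val_one, Matrix.cons_val, Rat.smul_def, mul_one]
    exact hrel)
  have e0 : a - a' = 0 := h3 0
  have e1 : (b - b') / 6 = 0 := h3 1
  have e2 : c - c' = 0 := h3 2
  refine ⟨by linarith, ?_, by linarith⟩
  have : b - b' = 0 := by linarith [show (b - b') / 6 * 6 = b - b' by ring]
  linarith

end BoxIntegral

end Literature.NumberTheory.Transcendental
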